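/-
Copyright (c) 2026 the pub-hodgecm-mathlib formalisation cell (harness21).  Prover seat hodgecm-mathlib-F0P3-p01 (g30), «(D-RAM) FOUR-FRAME» road of crux H413
(tier-1 socket `U1_Frames`, stub `stub_U1_fourFrameData`, brick 2): the scaled frame literal `z·Γ_b` is a UNITARY element of `GL₃` for norm-one `α, β, z`.  2026-09-03.
-/
import Literature.NumberTheory.Automorphic.UnitaryThreeFourFrameEigenframe   -- ★ p854605 (B-p04): `frameElt_mul_frameMatrix`, `isUnit_det_frameMatrix`; brings ★ #0a `frameElt`, `IsFourFrameFamily`, `pairing`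
import Literature.NumberTheory.Automorphic.UnitaryGroupFormCongrFinSum      -- ★ `formCongr_mul_eq`, `formCongr_one_eq`; brings ★ `formCongr_inv_formCongr`, `unitaryGroupOfForm`, `scalar_mem_unitaryGroupOfForm`
import HarnessLib

/-!
# The frame literal `Γ_b = 1 + (α−1)π₁^{(b)} + (β−1)π₂^{(b)}` as an element of `GL₃`, and `z·Γ_b ∈ U(σ, Φ₃)` for norm-one `α, β, z`

Topic `NumberTheory/Automorphic`; namespace `Literature.NumberTheory.Automorphic.UnitaryThreeFourFrame` (the namespace of ★ #0a `UnitaryThreeFourFrameDefs`).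
THEOREMS ONLY (no `def`, no instance, no notation, no `sorry`, no named fact); ABSTRACT (`K` any field, `σ : K →+* K`, a four-frame family `f`, H7).  Cell `pub/hodgecm-mathlib`
(D-0151), crux H413 = `stmt-HodgeConjecture-24833`, (D-RAM) «FOUR-FRAME» road, tier-1 socket `Cruxes/H413/Lines/F0_P3c_DyRamFourFrame_U1_Frames.lean`, stub
`stub_U1_fourFrameData` ∕ (D-CΔ) `FourFrameTransferFactor`: its last two ∃-witnesses are the GL literals `Γ_b` (`(Γ_b : M₃) = frameElt σ f b α β`) and the GROUP
literals `t_b ∈ U(Φ₃)(L⁺_v)` with one-place matrix `z·Γ_b`; the latter exist iff `z·Γ_b` lies in the one-place unitary group `U(σ_w, Φ₃)(L_w)` (★ `localNonsplitEquiv` is an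
isomorphism onto it).  THIS FILE supplies both, for every field.

THE MATHEMATICS ([Rogawski1990, §3.6 pp. 31–32]; [Jacobowitz1962, §4]).  `Q_b = (Matrix.of (f b))ᵀ` is the frame matrix (columns `f_{b,i}`), invertible (★ `isUnit_det_frameMatrix`),
and `Γ_b·Q_b = Q_b·D`, `D = diag(α, β, 1)` (★ `frameElt_mul_frameMatrix`), so `Γ_b = Q_b D Q_b⁻¹ ∈ GL₃` (§2).  The Gram matrix of the frame is `ᵗσ(Q_b)·Φ₃·Q_b =
diag(N f_{b,0}, N f_{b,1}, N f_{b,2}) =: G` (orthogonality, §1 `formCongr_frameMatrix`), and `ᵗσ(D)·G·D = diag(σ(λ_i)·N_i·λ_i) = G` when `σ(α)α = σ(β)β = 1`; hence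
`ᵗσ(Γ_b)Φ₃Γ_b = ᵗσ(Q_b⁻¹)·(ᵗσ(D) G D)·Q_b⁻¹ = ᵗσ(Q_b⁻¹) G Q_b⁻¹ = Φ₃` — `Γ_b ∈ U(σ, Φ₃)`; the norm-one scalar `z` is central unitary (★ `scalar_mem_unitaryGroupOfForm`), so
`z·Γ_b ∈ U(σ, Φ₃)` (§3).

* §1 `formCongr_apply_eq_pairing` (entries of `ᵗσ(T) H T` are the `H`-pairings of the columns of `T`), `formCongr_frameMatrix` (the Gram matrix of a frame is diagonal).
* §2 `exists_frameGL` (`Γ_b` as a `GL₃` element: `∃ Γ : GL₃, (Γ : M₃) = frameElt σ f b α β`, for `α, β ≠ 0`).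
* §3 **`exists_unitary_coe_eq_smul_frameElt`**: for `σ(α)α = σ(β)β = σ(z)z = 1` there is `U ∈ unitaryGroupOfForm σ Φ₃` with `(U : M₃) = z • frameElt σ f b α β`.

HONEST LABEL: HC_CM is proved only modulo the 7 printed citations (2 remaining named inputs: hLiu418 = stmt-HodgeConjecture-24832, h413 = stmt-HodgeConjecture-24833) until
rung 0 closes; `--supports stmt-HodgeConjecture-24833` helper, count-neutral linear algebra.

## References
* [Rogawski1990] J. D. Rogawski, *Automorphic Representations of Unitary Groups in Three Variables*, Ann. of Math. Stud. 123 (1990), §3.6 pp. 31–32, §4.9 p. 54.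
* [Jacobowitz1962] R. Jacobowitz, *Hermitian forms over local fields*, Amer. J. Math. 84 (1962) 441–465, §4.
-/

noncomputable section

open scoped Matrix MatrixGroups

namespace Literature.NumberTheory.Automorphic.UnitaryThreeFourFrame

open Literature.NumberTheory.Automorphic Literature.NumberTheory.Automorphic.UnitaryGroup Literature.NumberTheory.Automorphic.UnitaryLatticeTree

variable {K : Type} [Field K]

/-! ## §1  Entries of a congruent form are pairings of columns; the Gram matrix of a frame -/

/-- The `(i, j)` entry of `ᵗσ(T)·H·T` is the `H`-pairing of the columns `i` and `j` of `T`. [cite: Jacobowitz1962, §4] -/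
theorem formCongr_apply_eq_pairing {N : ℕ} (σ : K →+* K) (T : GL (Fin N) K) (H : Matrix (Fin N) (Fin N) K) (i j : Fin N) :
    formCongr σ T H i j = pairing σ H (fun a => (T : Matrix (Fin N) (Fin N) K) a i) (fun a => (T : Matrix (Fin N) (Fin N) K) a j) := by
  rw [pairing_apply]
  simp only [formCongr, Matrix.mul_apply, Matrix.transpose_apply, Matrix.map_apply, Finset.sum_mul]
  rw [Finset.sum_comm]

/-- **THE GRAM MATRIX OF A FRAME IS DIAGONAL**: for a four-frame family `f` (H7) and the frame matrix `Q_b = (Matrix.of (f b))ᵀ` (any `GL₃` element with these entries),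
`ᵗσ(Q_b)·Φ₃·Q_b = diag(N f_{b,0}, N f_{b,1}, N f_{b,2})`. [cite: Jacobowitz1962, §4] [cite: Rogawski1990, §3.6 p. 31] -/
theorem formCongr_frameMatrix {σ : K →+* K} {f : Fin 4 → Fin 3 → (Fin 3 → K)} (hf : IsFourFrameFamily σ f) (b : Fin 4)
    (Q : GL (Fin 3) K) (hQ : (Q : Matrix (Fin 3) (Fin 3) K) = (Matrix.of (f b))ᵀ) :
    formCongr σ Q ((StdForm.antidiagonal 3).over K) =
      Matrix.diagonal fun i => pairing σ ((StdForm.antidiagonal 3).over K) (f b i) (f b i) := by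
  obtain ⟨horth, -, -, -, -⟩ := hf b
  ext i j
  have hcol : ∀ k : Fin 3, (fun a => (Q : Matrix (Fin 3) (Fin 3) K) a k) = f b k := fun k => by
    funext a; rw [hQ, Matrix.transpose_apply, Matrix.of_apply]
  rw [formCongr_apply_eq_pairing, hcol, hcol]
  by_cases hij : i = j
  · subst hij; rw [Matrix.diagonal_apply_eq]
  · rw [Matrix.diagonal_apply_ne _ hij, horth i j hij]

/-! ## §2  The frame literal as a `GL₃` element -/

/-- `Γ_b = Q_b · diag(α, β, 1) · Q_b⁻¹` as matrices (★ `frameElt_mul_frameMatrix`). [cite: Rogawski1990, §3.6 p. 31] -/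
theorem frameElt_eq_conj_diagonal {σ : K →+* K} {f : Fin 4 → Fin 3 → (Fin 3 → K)} (hf : IsFourFrameFamily σ f) (b : Fin 4) (α β : K)
    (Q : GL (Fin 3) K) (hQ : (Q : Matrix (Fin 3) (Fin 3) K) = (Matrix.of (f b))ᵀ) :
    frameElt σ f b α β = (Q : Matrix (Fin 3) (Fin 3) K) * Matrix.diagonal ![α, β, 1] * ((Q⁻¹ : GL (Fin 3) K) : Matrix (Fin 3) (Fin 3) K) := by
  have h := frameElt_mul_frameMatrix hf b α β
  rw [← hQ] at h
  rw [← h, Matrix.mul_assoc, ← Units.val_mul, mul_inv_cancel, Units.val_one, Matrix.mul_one]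

/-- **`Γ_b ∈ GL₃`**: for `α, β ≠ 0` there is `Γ ∈ GL₃(K)` with `(Γ : M₃) = frameElt σ f b α β` (the GL literal of (D-CΔ)). [cite: Rogawski1990, §3.6 p. 31] -/
theorem exists_frameGL {σ : K →+* K} {f : Fin 4 → Fin 3 → (Fin 3 → K)} (hf : IsFourFrameFamily σ f) (b : Fin 4) {α β : K} (hα : α ≠ 0) (hβ : β ≠ 0) :
    ∃ Γ : GL (Fin 3) K, (Γ : Matrix (Fin 3) (Fin 3) K) = frameElt σ f b α β := by
  set Q : GL (Fin 3) K := ((Matrix.isUnit_iff_isUnit_det _).2 (isUnit_det_frameMatrix hf b)).unit with hQ_def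
  have hQ : (Q : Matrix (Fin 3) (Fin 3) K) = (Matrix.of (f b))ᵀ := rfl
  have hD : (Matrix.diagonal ![α, β, 1] : Matrix (Fin 3) (Fin 3) K).det ≠ 0 := by
    rw [Matrix.det_diagonal, Fin.prod_univ_three]
    simp only [Matrix.cons_val_zero, Matrix.cons_val_one, Matrix.cons_val_two, Matrix.head_cons, Matrix.tail_cons, mul_one]
    exact mul_ne_zero hα hβ
  refine ⟨Q * Matrix.GeneralLinearGroup.mkOfDetNeZero _ hD * Q⁻¹, ?_⟩
  rw [Units.val_mul, Units.val_mul, frameElt_eq_conj_diagonal hf b α β Q hQ]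
  rfl

/-! ## §3  `z·Γ_b` is unitary for norm-one `α, β, z` -/

/-- `ᵗσ(D)·G·D = G` for `D = diag(α, β, 1)`, `G = diag(N₀, N₁, N₂)`, `σ(α)α = σ(β)β = 1`. [cite: Rogawski1990, §3.6 p. 31] -/
theorem formCongr_diagonal_frameEigenvalues (σ : K →+* K) {α β : K} (hα : σ α * α = 1) (hβ : σ β * β = 1) (N : Fin 3 → K)
    (D : GL (Fin 3) K) (hD : (D : Matrix (Fin 3) (Fin 3) K) = Matrix.diagonal ![α, β, 1]) :
    formCongr σ D (Matrix.diagonal N) = Matrix.diagonal N := by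
  rw [formCongr, hD, Matrix.diagonal_map (map_zero σ), Matrix.diagonal_transpose, Matrix.diagonal_mul_diagonal, Matrix.diagonal_mul_diagonal]
  congr 1
  funext i
  fin_cases i
  · show σ α * N 0 * α = N 0
    rw [mul_right_comm, hα, one_mul]
  · show σ β * N 1 * β = N 1
    rw [mul_right_comm, hβ, one_mul]
  · show σ 1 * N 2 * 1 = N 2
    rw [map_one, one_mul, mul_one]

/-- **`z·Γ_b ∈ U(σ, Φ₃)` FOR NORM-ONE `α, β, z`** (`σ(α)α = σ(β)β = σ(z)z = 1`): there is `U ∈ unitaryGroupOfForm σ Φ₃` with `(U : M₃) = z • frameElt σ f b α β` — the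
one-place matrix of the group literal `t_b` of (D-CΔ) (`t_b := ι_w⁻¹ U`, ★ `localNonsplitEquiv`).  `Γ_b = Q_b D Q_b⁻¹`, `ᵗσ(Q_b)Φ₃Q_b = G` diagonal (§1), `ᵗσ(D) G D = G`,
`ᵗσ(Q_b⁻¹) G Q_b⁻¹ = Φ₃` (★ `formCongr_inv_formCongr`), and `z·1` is unitary (★ `scalar_mem_unitaryGroupOfForm`). [cite: Rogawski1990, §3.6 pp. 31–32; §4.9 p. 54] -/
theorem exists_unitary_coe_eq_smul_frameElt {σ : K →+* K} {f : Fin 4 → Fin 3 → (Fin 3 → K)} (hf : IsFourFrameFamily σ f) (b : Fin 4) {α β z : K}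
    (hα : σ α * α = 1) (hβ : σ β * β = 1) (hz : σ z * z = 1) :
    ∃ U : GL (Fin 3) K, U ∈ unitaryGroupOfForm σ ((StdForm.antidiagonal 3).over K) ∧ (U : Matrix (Fin 3) (Fin 3) K) = z • frameElt σ f b α β := by
  have hα0 : α ≠ 0 := fun h => by rw [h, mul_zero] at hα; exact zero_ne_one hα
  have hβ0 : β ≠ 0 := fun h => by rw [h, mul_zero] at hβ; exact zero_ne_one hβ
  have hz0 : z ≠ 0 := fun h => by rw [h, mul_zero] at hz; exact zero_ne_one hz
  set Q : GL (Fin 3) K := ((Matrix.isUnit_iff_isUnit_det _).2 (isUnit_det_frameMatrix hf b)).unit with hQ_def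
  have hQ : (Q : Matrix (Fin 3) (Fin 3) K) = (Matrix.of (f b))ᵀ := rfl
  have hDdet : (Matrix.diagonal ![α, β, 1] : Matrix (Fin 3) (Fin 3) K).det ≠ 0 := by
    rw [Matrix.det_diagonal, Fin.prod_univ_three]
    simp only [Matrix.cons_val_zero, Matrix.cons_val_one, Matrix.cons_val_two, Matrix.head_cons, Matrix.tail_cons, mul_one]
    exact mul_ne_zero hα0 hβ0
  set D : GL (Fin 3) K := Matrix.GeneralLinearGroup.mkOfDetNeZero _ hDdet with hD_def
  have hD : (D : Matrix (Fin 3) (Fin 3) K) = Matrix.diagonal ![α, β, 1] := rfl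
  -- `Γ_b = Q D Q⁻¹` is unitary
  have hΓmem : Q * D * Q⁻¹ ∈ unitaryGroupOfForm σ ((StdForm.antidiagonal 3).over K) := by
    rw [mem_unitaryGroupOfForm_iff]
    change formCongr σ (Q * D * Q⁻¹) ((StdForm.antidiagonal 3).over K) = (StdForm.antidiagonal 3).over K
    rw [formCongr_mul_eq, formCongr_mul_eq, formCongr_frameMatrix hf b Q hQ, formCongr_diagonal_frameEigenvalues σ hα hβ _ D hD,
      ← formCongr_frameMatrix hf b Q hQ, formCongr_inv_formCongr]
  -- the norm-one scalar `z`
  have hzmem := scalar_mem_unitaryGroupOfForm σ ((StdForm.antidiagonal 3).over K) (Units.mk0 z hz0) (by rw [Units.val_mk0]; exact hz)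
  refine ⟨Units.map (Matrix.scalar (Fin 3) : K →+* Matrix (Fin 3) (Fin 3) K).toMonoidHom (Units.mk0 z hz0) * (Q * D * Q⁻¹), Subgroup.mul_mem _ hzmem hΓmem, ?_⟩
  rw [Units.val_mul, Units.val_mul, Units.val_mul, frameElt_eq_conj_diagonal hf b α β Q hQ, Units.coe_map, Units.val_mk0, ← hD]
  change (Matrix.scalar (Fin 3) z) * _ = _
  rw [Matrix.scalar_apply, ← Matrix.smul_eq_diagonal_mul]

end Literature.NumberTheory.Automorphic.UnitaryThreeFourFrame

end
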